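import Literature.AlgebraicGeometry.HodgeTheory.StablyNondegenerateProducts
import Literature.AlgebraicGeometry.HodgeTheory.RealMultiplicationRelDimTwoPowersHodgeClasses
import HarnessLib

/-!
# Real multiplication of relative dimension two is stably nondegenerate (Moonen–Zarhin 1995 Type I(2); Murty 1984 §3 / Gordon Thm. 7.5): `B•(Aⁿ) = D•(Aⁿ)` for all `n` when `End⁰(A) = F` is a totally real field with `dim A = 2[F:ℚ]` — unconditional; products modulo Hazama

Family `hodge`, layer `Literature/AlgebraicGeometry/HodgeTheory`. Research context: cell `pub-hodge-ring2`
(HONEST FRAMING: research route conditional on HC_CM; not a corollary; Q11.4-sentence-2 already refuted in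
dim ≥ 3), Literature lane gen 70, programme R47 — the relative-dimension-TWO instances of the tree's notion
`IsStablyNondegenerate` (`StablyNondegenerateProducts`, Gordon 7.5–7.6 / Moonen–Zarhin condition (D)), exactly as
its §2/§4 do for relative dimension one. THEOREMS ONLY (no definition, no named fact; D-0026); §1 UNCONDITIONAL
(`AVSlots.isDivisorGenerated_of_isTotallyReal_of_two_mul_finrank_eq`, `RealMultiplicationRelDimTwoPowersHodgeClasses`);
§2 modulo the tree's named fact `Hazama1989_stablyNondegenerate_prod` (binder `h`, never asserted) and, with a CM factor,
the binders `hCM` (HC_CM) and `hL` (Lombardo); no step towards a summit statement.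

PUBLISHED STATEMENTS (held `paper:arxiv-alg-geom_9709030` p0020–p0021): Gordon 7.5 «(1) `Hdg(Aᵏ) = Div(Aᵏ)` for all
`k ≥ 1` ⟺ (2) no factor of type (III) and `Hg(A) = Lf(A)`», 7.6 (stably nondegenerate), 7.6.2 (Hazama 1989: products of
stably nondegenerate type-IV-free varieties); Murty 1984 §3 (Prop. 7.7.1); Moonen–Zarhin 1995 Type I(2): `Hg = Lf`.

MAIN RESULTS. §1 `isStablyNondegenerate_of_isTotallyReal_of_two_mul_finrank_eq`,
`isStablyNondegenerate_powSucc_of_isTotallyReal_of_two_mul_finrank_eq` (unconditional). §2 (modulo Hazama)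
`isStablyNondegenerate_powSucc_prod_powSucc_of_relDimTwo_of_hazama` (two relative-dimension-two factors),
`isStablyNondegenerate_powSucc_prod_powSucc_of_relDimTwo_relDimOne_of_hazama` (mixed with relative dimension one),
`hodgeConjectureFor_of_isIsogenous_…` and the CM-factor form
`hodgeConjectureFor_powSucc_prod_powSucc_prod_cmType_of_relDimTwo_of_hazama_of_cmHodgeHypothesis`.

## References

* [Gordon1999HodgeAVSurvey] B. B. Gordon, *A survey of the Hodge conjecture for abelian varieties*, Thm. 7.5, Def. 7.6,
  Thm. 7.6.2. [cite: Gordon1999HodgeAVSurvey, Thm. 7.5 (1) and Def. 7.6]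
* [Hazama1989] F. Hazama, Duke Math. J. 58 (1989) 31–37. [cite: Hazama1989, Thm. (= Gordon 7.6.2)]
* [MoonenZarhin1995Duke] B. Moonen, Yu. Zarhin, Duke Math. J. 77 (1995), Type I(2). [cite: MoonenZarhin1995Duke, Type I(2)]
* [Murty1984] V. K. Murty, Math. Ann. 268 (1984), §3. [cite: Murty1984, §3]
* [MoonenZarhin1999LowDim] B. Moonen, Yu. Zarhin, Math. Ann. 315 (1999), §2 (D), §3 Thm. (3.2). [cite: MoonenZarhin1999LowDim, §3 Thm. (3.2)]
* [Lombardo2016] D. Lombardo, Ann. Inst. Fourier 66 (2016), Lemma 3.4. [cite: Lombardo2016, Lemma 3.4 (p. 1229)]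
-/

noncomputable section

open CategoryTheory Module NumberField

namespace Literature.AlgebraicGeometry.HodgeTheory

open Literature.AlgebraicGeometry.Motives (AbelianVariety)
open Literature.AlgebraicGeometry.ComplexMultiplication
open Literature.AlgebraicGeometry.Milne1999

/-! ### §1 Relative dimension two is stably nondegenerate — unconditional -/

/-- **Real multiplication of relative dimension two is stably nondegenerate — UNCONDITIONAL** (Moonen–Zarhin Type
I(2), Murty 1984 §3 with Ribet Thm. 0: `Hdg(Aⁿ) = Div(Aⁿ)` for all `n` when `End⁰(A)` is a totally real field `F`
with `2[F:ℚ] = dim A`; the tree's `AbelianVariety.isDivisorGenerated_powSucc_of_isTotallyReal_of_two_mul_finrank_eq`).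
[cite: MoonenZarhin1995Duke, Type I(2)] [cite: Murty1984, §3] [cite: Gordon1999HodgeAVSurvey, Thm. 7.5 (1) and Def. 7.6] -/
theorem isStablyNondegenerate_of_isTotallyReal_of_two_mul_finrank_eq (A : AbelianVariety ℂ)
    (hF : IsField A.endAlgebra) [IsTotallyReal (EndField A hF)]
    (hdeg : 2 * Module.finrank ℚ A.endAlgebra = A.dim) : IsStablyNondegenerate A :=
  fun N => AbelianVariety.isDivisorGenerated_powSucc_of_isTotallyReal_of_two_mul_finrank_eq A hF hdeg N

/-- **All powers `A^{M+1}` of a relative-dimension-two real-multiplication variety are stably nondegenerate —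
UNCONDITIONAL** (the iterated powers have slots over `A`, `exists_avSlots_powSucc_powSucc`;
`AVSlots.isDivisorGenerated_of_isTotallyReal_of_two_mul_finrank_eq`). [cite: MoonenZarhin1995Duke, Type I(2)]
[cite: Gordon1999HodgeAVSurvey, Rem. 7.6.1] -/
theorem isStablyNondegenerate_powSucc_of_isTotallyReal_of_two_mul_finrank_eq (A : AbelianVariety ℂ)
    (hF : IsField A.endAlgebra) [IsTotallyReal (EndField A hF)]
    (hdeg : 2 * Module.finrank ℚ A.endAlgebra = A.dim) (M : ℕ) : IsStablyNondegenerate (A.powSucc M) := by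
  intro K
  obtain ⟨n, g, hg⟩ := exists_avSlots_powSucc_powSucc A M K
  exact hg.isDivisorGenerated_of_isTotallyReal_of_two_mul_finrank_eq hF hdeg

/-! ### §2 Products, modulo Hazama 1989 (and HC_CM ∧ Lombardo with a CM factor) -/

/-- **Two real-multiplication varieties of relative dimension two, modulo Hazama ONLY**: `A^{M+1} × B^{N+1}` is
stably nondegenerate (both factors unconditionally so and type-IV-free, `hasNoTypeIVFactor_of_isTotallyReal`).
[cite: Hazama1989, Thm. (= Gordon 7.6.2)] [cite: MoonenZarhin1995Duke, Type I(2)] -/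
theorem isStablyNondegenerate_powSucc_prod_powSucc_of_relDimTwo_of_hazama
    (h : Hazama1989_stablyNondegenerate_prod) (A B : AbelianVariety ℂ) (hFA : IsField A.endAlgebra)
    [IsTotallyReal (EndField A hFA)] (hdegA : 2 * Module.finrank ℚ A.endAlgebra = A.dim)
    (hFB : IsField B.endAlgebra) [IsTotallyReal (EndField B hFB)]
    (hdegB : 2 * Module.finrank ℚ B.endAlgebra = B.dim) (M N : ℕ) :
    IsStablyNondegenerate ((A.powSucc M).prod (B.powSucc N)) :=
  (isStablyNondegenerate_powSucc_of_isTotallyReal_of_two_mul_finrank_eq A hFA hdegA M).prod_of_hazama h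
    (isStablyNondegenerate_powSucc_of_isTotallyReal_of_two_mul_finrank_eq B hFB hdegB N)
    ((hasNoTypeIVFactor_of_isTotallyReal A hFA).powSucc M)
    ((hasNoTypeIVFactor_of_isTotallyReal B hFB).powSucc N)

/-- **Mixed relative dimensions two and one, modulo Hazama ONLY**: `A^{M+1} × B^{N+1}` is stably nondegenerate for
`A` of relative dimension two and `B` of relative dimension one (Ribet 1983 Thm. 0, the tree's
`isStablyNondegenerate_powSucc_of_isTotallyReal`). [cite: Hazama1989, Thm. (= Gordon 7.6.2)]
[cite: MoonenZarhin1995Duke, Type I(2)] -/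
theorem isStablyNondegenerate_powSucc_prod_powSucc_of_relDimTwo_relDimOne_of_hazama
    (h : Hazama1989_stablyNondegenerate_prod) (A B : AbelianVariety ℂ) (hFA : IsField A.endAlgebra)
    [IsTotallyReal (EndField A hFA)] (hdegA : 2 * Module.finrank ℚ A.endAlgebra = A.dim)
    (hFB : IsField B.endAlgebra) [IsTotallyReal (EndField B hFB)]
    (hdegB : Module.finrank ℚ B.endAlgebra = B.dim) (M N : ℕ) :
    IsStablyNondegenerate ((A.powSucc M).prod (B.powSucc N)) :=
  (isStablyNondegenerate_powSucc_of_isTotallyReal_of_two_mul_finrank_eq A hFA hdegA M).prod_of_hazama h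
    (isStablyNondegenerate_powSucc_of_isTotallyReal B hFB hdegB N)
    ((hasNoTypeIVFactor_of_isTotallyReal A hFA).powSucc M)
    ((hasNoTypeIVFactor_of_isTotallyReal B hFB).powSucc N)

/-- **HC for every power of `A^{M+1} × B^{N+1}` and everything isogenous to one, `A`, `B` real multiplication
of relative dimension two — modulo Hazama ONLY (no HC_CM).** [cite: Hazama1989, Thm. (= Gordon 7.6.2)]
[cite: MoonenZarhin1995Duke, Type I(2)] -/
theorem hodgeConjectureFor_of_isIsogenous_powSucc_powSucc_prod_powSucc_of_relDimTwo_of_hazama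
    (h : Hazama1989_stablyNondegenerate_prod) {X : AbelianVariety ℂ} (A B : AbelianVariety ℂ)
    (hFA : IsField A.endAlgebra) [IsTotallyReal (EndField A hFA)]
    (hdegA : 2 * Module.finrank ℚ A.endAlgebra = A.dim) (hFB : IsField B.endAlgebra)
    [IsTotallyReal (EndField B hFB)] (hdegB : 2 * Module.finrank ℚ B.endAlgebra = B.dim) {M N K : ℕ}
    (hX : AbelianVariety.IsIsogenous X (((A.powSucc M).prod (B.powSucc N)).powSucc K)) :
    HodgeConjectureFor X.dim X.X :=
  (isStablyNondegenerate_powSucc_prod_powSucc_of_relDimTwo_of_hazama h A B hFA hdegA hFB hdegB M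
    N).hodgeConjectureFor_of_isIsogenous_powSucc hX

/-- The `K = 0` spelling: HC(`A^{M+1} × B^{N+1}`) modulo Hazama only, relative dimension two.
[cite: Hazama1989, Thm. (= Gordon 7.6.2)] [cite: MoonenZarhin1995Duke, Type I(2)] -/
theorem hodgeConjectureFor_powSucc_prod_powSucc_of_relDimTwo_of_hazama
    (h : Hazama1989_stablyNondegenerate_prod) (A B : AbelianVariety ℂ) (hFA : IsField A.endAlgebra)
    [IsTotallyReal (EndField A hFA)] (hdegA : 2 * Module.finrank ℚ A.endAlgebra = A.dim)
    (hFB : IsField B.endAlgebra) [IsTotallyReal (EndField B hFB)]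
    (hdegB : 2 * Module.finrank ℚ B.endAlgebra = B.dim) (M N : ℕ) :
    HodgeConjectureFor ((A.powSucc M).prod (B.powSucc N)).dim ((A.powSucc M).prod (B.powSucc N)).X :=
  (isStablyNondegenerate_powSucc_prod_powSucc_of_relDimTwo_of_hazama h A B hFA hdegA hFB hdegB M N).hodgeConjectureFor

/-- **With a CM factor: HC_CM ∧ Lombardo ∧ Hazama ⟹ HC(`(A^{M+1} × B^{N+1}) × C`)**, `A`, `B` real multiplication
of relative dimension two, `C` of CM type (the product-lane frame `hodgeConjectureFor_prod_of_cmHodgeHypothesis`).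
Binders displayed: `hCM` (HC_CM, Milne's per-variety form), `hL` (`Lombardo2016_hodgeClassesProductSpan`), `h`
(Hazama 1989). [cite: Hazama1989, Thm. (= Gordon 7.6.2)] [cite: Lombardo2016, Lemma 3.4 (p. 1229)]
[cite: MoonenZarhin1999LowDim, §3 Thm. (3.2)(1)] -/
theorem hodgeConjectureFor_powSucc_prod_powSucc_prod_cmType_of_relDimTwo_of_hazama_of_cmHodgeHypothesis
    (hCM : ∀ B : AbelianVariety ℂ, Milne1999.CMHodgeHypothesisAt B)
    (hL : Lombardo2016_hodgeClassesProductSpan) (h : Hazama1989_stablyNondegenerate_prod)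
    (A B C : AbelianVariety ℂ) (hFA : IsField A.endAlgebra) [IsTotallyReal (EndField A hFA)]
    (hdegA : 2 * Module.finrank ℚ A.endAlgebra = A.dim) (hFB : IsField B.endAlgebra)
    [IsTotallyReal (EndField B hFB)] (hdegB : 2 * Module.finrank ℚ B.endAlgebra = B.dim) (M N : ℕ)
    (hCt : Milne1999.IsOfCMType C) :
    HodgeConjectureFor (((A.powSucc M).prod (B.powSucc N)).prod C).dim
      (((A.powSucc M).prod (B.powSucc N)).prod C).X :=
  hodgeConjectureFor_prod_of_cmHodgeHypothesis hCM hL ((A.powSucc M).prod (B.powSucc N)) C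
    ((hasNoTypeIVFactor_of_isTotallyReal A hFA).powSucc_prod_powSucc (hasNoTypeIVFactor_of_isTotallyReal B hFB)
      M N) hCt
    (hodgeConjectureFor_powSucc_prod_powSucc_of_relDimTwo_of_hazama h A B hFA hdegA hFB hdegB M N)

end Literature.AlgebraicGeometry.HodgeTheory

end
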